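import Summits.BirchSwinnertonDyer.BirchSwinnertonDyer.Theorems.RamifiedHeegnerPairTwistUnitInertZero
import HarnessLib

/-!
# U₀ at the two-SPLIT-carrier Gss2 classes (rank zero; the Shimura rows), TU₀|inert — part O: `426915p1`, `438570z1`

Continuation of `…Theorems.RamifiedHeegnerPairTwistUnitInertZero` (seat `bsd-trib-w-rhp` g14; the two rank-zero doors
`leafRankZeroUpper_three_of_twoCarriers_of_sqrtField` / `leafRankZeroUpper_three_of_twoInert_twoOutside_of_sqrtField` and the full framing are there; the generic
kernel lemmas are in `…TwistUnitInert`): per rank-zero curve `subGss_three_<label>` (Addv ∧ SubGss at `3` in the kernel), `Δ_eq_/c₄_eq_/krausList_<label>`, Kraus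
minimality of `V = E^{(-3)}_min` and of the twist model `Wd`, and `u0_at_<label> : … → MissingUpperBoundAt W 3` by rhp-p2 g10's certificate shape p662479
`LeafShimuraInert.leafRankZeroUpper_three_of_shimuraInertDatum_of_twistUnitZero` with the six printed facts `hGZK hmod hnf hJL hCO hHK` as hypotheses, the split / no-split / Tate
certificates, `hothers`, `hshape` and the field congruences IN THE KERNEL, and `hN hr Dt hc` + `L(E^D,1) = 0 ≠ L′(E^D,1)` + `#Ш(Wd)_an` DISPLAYED (census kit j318499:
rank-one-twist certificates `X = L′·T²/(Ω·∏c·ĥ)` at a saturated point).  **HONEST FRAMING: theorems only; nothing is booked, no item is closed; U₀ (26024) /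
TU₀|inert / the Shimura-curve Gross–Zagier–Kolyvagin inputs stay research-level and OPEN class-wide; BSD is NOT proved for any curve by this file.**
[cite: JetchevSkinnerWan2017, §7.4.2 (p. 31), Thm. 4.4.1 (p. 19)] [cite: PastenShimura2024, Prop. 6.13, Lemma 6.16, Lemma 6.18 (pp. 23–24)]
[cite: PapikianRabinoff2016, Cor. 3.5] [cite: SilvermanAEC2009, VII.5 Prop. 5.1] [cite: SilvermanATAEC1994, IV.9.4] [cite: Tate1975, §7] [cite: Kraus1989, Prop. 1]
[cite: Marcus2018, Ch. 3 Thm. 25] [cite: Miller2011LMS, Def. 1.1] [cite: Cremona2006, Table 1]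
-/

set_option linter.dupNamespace false
set_option autoImplicit false

noncomputable section

open scoped Classical NumberField

open WeierstrassCurve NumberField IsDedekindDomain IsDedekindDomain.HeightOneSpectrum Rat.HeightOneSpectrum Field Literature Literature.NumberTheory.DiophantineGeometry
  Literature.NumberTheory.EllipticCurves Literature.NumberTheory.EllipticCurves.ModularForms Literature.NumberTheory.EllipticCurves.Rank1Residual
  Literature.NumberTheory.EllipticCurves.Rank1Residual.Typed Literature.NumberTheory.Automorphic Literature.NumberTheory.EllipticCurves.Rank1Residual.X11RankOneCertificates
  Literature.NumberTheory.EllipticCurves.KrizLi2019 Literature.NumberTheory.GaloisRepresentations Literature.NumberTheory.QuadraticFields Literature.NumberTheory.QuadraticFields.Quadratic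
  Summit.BirchSwinnertonDyer.BirchSwinnertonDyer.Rank1Residual Summit.BirchSwinnertonDyer.BirchSwinnertonDyer.Rank1Residual.IntModel
  Summit.BirchSwinnertonDyer.BirchSwinnertonDyer.Rank2Observatory.Tam Summit.BirchSwinnertonDyer.Rank1Residual Summit.BirchSwinnertonDyer.Rank1Residual.Additive
  Summit.BirchSwinnertonDyer.Rank1Residual.X11b Summit.BirchSwinnertonDyer.Rank1Residual.X11b.Three Summit.BirchSwinnertonDyer.Rank1Residual.X9 Summit.BirchSwinnertonDyer.Rank1Residual.GaloisImage
  Summit.BirchSwinnertonDyer.Rank1Residual.Supersingular Summit.BirchSwinnertonDyer.BirchSwinnertonDyer.Theses.RamifiedHeegnerPair Summit.BirchSwinnertonDyer.BirchSwinnertonDyer.Theorems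
  Summit.BirchSwinnertonDyer.BirchSwinnertonDyer.Theorems.SchneiderFree Summit.BirchSwinnertonDyer.BirchSwinnertonDyer.Theorems.RamifiedPairUpperBound
  Summit.BirchSwinnertonDyer.BirchSwinnertonDyer.Theorems.RamifiedHeegnerPairStepLIntrinsic Summit.BirchSwinnertonDyer.BirchSwinnertonDyer.Theorems.AdditiveBranchIMCGordTwoRankOne.HeegnerKolyvagin
  Summit.BirchSwinnertonDyer.BirchSwinnertonDyer.Theorems.RamifiedHeegnerPairTwistUnitIntrinsic Summit.BirchSwinnertonDyer.BirchSwinnertonDyer.Theorems.RamifiedHeegnerPairTwistUnitAdditive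

namespace Summit.BirchSwinnertonDyer.BirchSwinnertonDyer.Theorems.RamifiedHeegnerPairTwistUnitInertZero

open RamifiedHeegnerPairTwistUnitInert

/-! ## §27 `426915p1` = `[1, -1, 0, 3351, -7732]`, `N = 426915 = 3^2·5·53·179` (`3`: I₀*, `c = 1`, `5`: I3, `c = 3`, split, `53`: I3, `c = 3`, split, `179`: I1, `c = 1`, non-split); carriers `S = {5, 53}` (split, `3 ∣ ord Δ`), (DEG) by Papikian–Rabinoff at `q₂ = 53` (odd, `≡ 2 (mod 3)`);
`r_an = 0`, `#E(ℚ)_tors = 1`, `∏ c_ℓ = 9`, `#Ш(E)_an = 1` (Cremona/LMFDB, displayed where used); class `426915p` of size 1.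
`V = E^{(-3)}_min = [1, -1, 1, 372, 162]` (`#Ṽ(𝔽₃) = 7`).  JSW field `K = ℚ(√-23)` (`23` prime; `5`, `53` inert, every other `ℓ ∣ N` split): the least such `D` (among those tried) with a CERTIFIED twist unit
(kit j318499: root no. `−1`, `L′(Wd,1) = 6.423345`, `Wd = E^{(-23)}_min = [1, -1, 0, 1772580, 83439575]`, `N(Wd) = 225838035`, `∏c = 2`, `T = 1`, point by `ellrank(effort=0)`, eclib-full saturation (index 1), `ĥ = 31.241806`,
`X = L′T²/(Ω∏c ĥ) = 1` to `0e+00` — the numerical `#Ш(Wd)_an` given rank `1`). -/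

/-- `V = [1, -1, 1, 372, 162]` (the minimal model of `426915p1^{(-3)}`, conductor `47435`): `Δ ≠ 0` in the kernel. [cite: Cremona2006, Table 1 (Cremona label 426915p1)] -/
theorem isElliptic_sV426915p1 : (⟨1, -1, 1, 372, 162⟩ : WeierstrassCurve ℚ).IsElliptic :=
  isElliptic_of_discOf_ne_zero 1 (-1) 1 372 162 (by decide +kernel)

/-- `V` is globally minimal: `|Δ| = 5^3·53^3·179` kernel-checked, Kraus' criterion prime by prime. [cite: Kraus1989, Prop. 1 and Prop. 2]
[cite: SilvermanAEC2009, VII.1 Remark 1.1] [cite: Cremona2006, Table 1 (Cremona label 426915p1)] -/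
theorem isGloballyMinimal_sV426915p1 : (⟨1, -1, 1, 372, 162⟩ : WeierstrassCurve ℚ).IsGloballyMinimal :=
  isGloballyMinimal_of_krausCriterion₃_factored 1 (-1) 1 372 162
    [(5, 3), (53, 3), (179, 1)] (by decide +kernel)
    (by intro qe hqe; simp only [List.mem_cons, List.not_mem_nil, or_false] at hqe
        rcases hqe with rfl | rfl | rfl <;> norm_num)
    (by set_option synthInstance.maxSize 2000 in decide +kernel)

/-- `Wd = [1, -1, 0, 1772580, 83439575]` (the minimal model of the twist `426915p1^{(-23)}`, conductor `225838035`): `Δ ≠ 0` in the kernel. [cite: Cremona2006, Table 1 (Cremona label 426915p1)] -/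
theorem isElliptic_sWd426915p1 : (⟨1, -1, 0, 1772580, 83439575⟩ : WeierstrassCurve ℚ).IsElliptic :=
  isElliptic_of_discOf_ne_zero 1 (-1) 0 1772580 83439575 (by decide +kernel)

/-- `Wd` is globally minimal: `|Δ| = 3^6·5^3·23^6·53^3·179` kernel-checked, Kraus' criterion prime by prime. [cite: Kraus1989, Prop. 1 and Prop. 2]
[cite: SilvermanAEC2009, VII.1 Remark 1.1] [cite: Cremona2006, Table 1 (Cremona label 426915p1)] -/
theorem isGloballyMinimal_sWd426915p1 : (⟨1, -1, 0, 1772580, 83439575⟩ : WeierstrassCurve ℚ).IsGloballyMinimal :=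
  isGloballyMinimal_of_krausCriterion₃_factored 1 (-1) 0 1772580 83439575
    [(3, 6), (5, 3), (23, 6), (53, 3), (179, 1)] (by decide +kernel)
    (by intro qe hqe; simp only [List.mem_cons, List.not_mem_nil, or_false] at hqe
        rcases hqe with rfl | rfl | rfl | rfl | rfl <;> norm_num)
    (by set_option synthInstance.maxSize 2000 in decide +kernel)

/-- **`426915p1` is ADDITIVE at `3` and on the cell (G) ∧ ss, IN THE KERNEL**: `3 ∣ Δ`, `3 ∣ c₄`; `C • V^{(-3)} = E` (`[u, r, s, t] = [1, -1, 1/2, 0]`) with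
`V` globally minimal, `3 ∤ Δ(V)`, `#Ṽ(𝔽₃) = 7` (`a₃(V) = -3`, supersingular), whence `TypeG`, `SubGord`, `SubGss` at `3` (g13's block, unchanged).
[cite: SilvermanAEC2009, VII.5 Prop. 5.1 (a), (c)] [cite: Delbourgo1998, §1.5 (G)] [cite: Cremona2006, Table 1 (Cremona label 426915p1)] -/
theorem subGss_three_426915p1 {W : WeierstrassCurve ℚ} [W.IsElliptic] [W.IsGloballyMinimal] (hWeq : W = (⟨1, -1, 0, 3351, -7732⟩ : WeierstrassCurve ℚ)) :
    Addv W 3 ∧ SubGss W 3 := by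
  subst hWeq
  haveI := isElliptic_sV426915p1
  haveI := isGloballyMinimal_sV426915p1
  have hIW : integralModelInt (⟨1, -1, 0, 3351, -7732⟩ : WeierstrassCurve ℚ) = (⟨1, -1, 0, 3351, -7732⟩ : WeierstrassCurve ℤ) :=
    integralModelInt_eq_of_map_eq _ (map_mk_int 1 (-1) 0 3351 (-7732))
  have hadd : Addv (⟨1, -1, 0, 3351, -7732⟩ : WeierstrassCurve ℚ) 3 := Additive.addv_of_intModel hIW 3 (by decide +kernel) (by decide +kernel)
  have hIV : integralModelInt (⟨1, -1, 1, 372, 162⟩ : WeierstrassCurve ℚ) = (⟨1, -1, 1, 372, 162⟩ : WeierstrassCurve ℤ) :=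
    integralModelInt_eq_of_map_eq _ (map_mk_int 1 (-1) 1 372 162)
  have hcV : Nat.card ((((⟨1, -1, 1, 372, 162⟩ : WeierstrassCurve ℤ)).map (Int.castRingHom (ZMod 3))).toAffine.Point) = 7 := by
    have h := natCard_point_eq_countPoints 1 (-1) 1 372 162 3 (by norm_num) (by decide +kernel)
    have h' : countPoints [1, -1, 1, 372, 162] 3 = 7 := countPoints_eq_of_fast (by decide +kernel)
    exact_mod_cast h.trans h'
  have hgood : GoodSS (⟨1, -1, 1, 372, 162⟩ : WeierstrassCurve ℚ) 3 := Supersingular.goodSS_of_intModel 3 hIV (by decide +kernel) hcV (by decide)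
  have hVW : (⟨1, (-1 : ℚ), ((1:ℚ)/2), (0 : ℚ)⟩ : VariableChange ℚ) • (⟨1, -1, 1, 372, 162⟩ : WeierstrassCurve ℚ).quadraticTwist (-3) =
      (⟨1, -1, 0, 3351, -7732⟩ : WeierstrassCurve ℚ) := by
    ext <;> simp [WeierstrassCurve.variableChange_a₁, WeierstrassCurve.variableChange_a₂,
      WeierstrassCurve.variableChange_a₃, WeierstrassCurve.variableChange_a₄, WeierstrassCurve.variableChange_a₆,
      WeierstrassCurve.quadraticTwist, WeierstrassCurve.b₂, WeierstrassCurve.b₄, WeierstrassCurve.b₆] <;> norm_num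
  obtain ⟨C, hC⟩ := exists_variableChange_quadraticTwist_symm (⟨1, -1, 0, 3351, -7732⟩ : WeierstrassCurve ℚ)
    (⟨1, -1, 1, 372, 162⟩ : WeierstrassCurve ℚ) (d := (-3 : ℚ)) (by norm_num) ⟨_, hVW⟩
  have hC' : C • (⟨1, -1, 0, 3351, -7732⟩ : WeierstrassCurve ℚ).quadraticTwist ((-1 : ℚ) ^ ((3 : ℕ) / 2) * (3 : ℕ)) =
      (⟨1, -1, 1, 372, 162⟩ : WeierstrassCurve ℚ) := by
    rw [O5.pstar_three]; exact hC
  have hG : TypeG (⟨1, -1, 0, 3351, -7732⟩ : WeierstrassCurve ℚ) 3 := (typeG_three_iff_good_twist _ hadd _ C hC').mpr hgood.1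
  exact ⟨hadd, (O5.subGss_three_iff_subGord_and_goodSS_twist _ hadd _ C hC).mpr
    ⟨subGord_three_of_typeG_of_addv _ hG hadd, hgood⟩⟩

/-- `Δ(E₀) = -2428388575875 = -3^6·5^3·53^3·179` on the integer equation of `426915p1`. [cite: Cremona2006, Table 1 (Cremona label 426915p1)] -/
theorem Δ_eq_426915p1 : (⟨1, -1, 0, 3351, -7732⟩ : WeierstrassCurve ℤ).Δ = -2428388575875 := by
  norm_num [WeierstrassCurve.Δ, WeierstrassCurve.b₂, WeierstrassCurve.b₄, WeierstrassCurve.b₆, WeierstrassCurve.b₈]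

/-- `c₄(E₀) = -160839` on the integer equation of `426915p1`. [cite: Cremona2006, Table 1 (Cremona label 426915p1)] -/
theorem c₄_eq_426915p1 : (⟨1, -1, 0, 3351, -7732⟩ : WeierstrassCurve ℤ).c₄ = -160839 := by
  norm_num [WeierstrassCurve.c₄, WeierstrassCurve.b₂, WeierstrassCurve.b₄]

/-- The Kraus list of `426915p1` consists of primes and multiplies to `|Δ(E₀)|`, IN THE KERNEL: a prime dividing `Δ_min` is one of `[3, 5, 53, 179]`. [cite: Cremona2006, Table 1 (Cremona label 426915p1)] -/
theorem krausList_426915p1 : (∀ qe ∈ ([(3, 6), (5, 3), (53, 3), (179, 1)] : List (ℕ × ℕ)), qe.1.Prime) ∧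
    (([(3, 6), (5, 3), (53, 3), (179, 1)] : List (ℕ × ℕ)).map fun qe => qe.1 ^ qe.2).prod = (-2428388575875 : ℤ).natAbs :=
  ⟨by decide +kernel, by decide +kernel⟩

/-- **U₀ AT `426915p1` BY THE INERT-CARRIER (Shimura-curve) ROAD, TU₀|inert** — `MissingUpperBoundAt W 3` at `W = E` (`r_an = 0`) from rhp-p2 g10's certificate shape
p662479 `leafRankZeroUpper_three_of_shimuraInertDatum_of_twistUnitZero` (Papikian–Rabinoff (DEG) at the odd carrier) through the §0 door `leafRankOneUpper_three_of_twoCarriers_of_sqrtField` of part one.  PRINTED: `hGZK hmod hnf hJL hCO hHK`.  KERNEL: `Addv ∧ SubGss` at `3`;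
`5`, `53` split (nodal roots `0`, `25`); every prime of `Δ_min` enumerated (`krausList_426915p1`) for `hothers` and `hshape` (`c = 1` off `Δ_min`, Kodaira–Néron at the
multiplicative primes, Tate certificates at the additive primes `[3]`); the congruences making `5`, `53` inert and the other `ℓ ∣ N` split in `ℚ(√-23)`; the twist
identity `Cd • E^{(-23)} = Wd`, `Cd = [1, -6, 1/2, 0]`, with `Wd` Kraus-minimal.  DISPLAYED: `hN`, `hr` (`r_an = 0`), `Dt`/`hc` (`3 ∤ c(Dt)`), `hLt0`/`hLt1` (`L(E^{(-23)},1) = 0 ≠ L′(E^{(-23)},1)`; census: root number `−1`, `L′(Wd,1) ≈ 6.423345`),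
`hqd`/`hvd` (`#Ш(Wd)_an = 1`; census: `X = L′·T²/(Ω·∏c·ĥ(P)) = 1` to `0.0e+00` at the eclib-full-saturated point `P` of height `31.241806` found by `ellrank(effort=0)`).
NO ¬CM / S2 / Σ / L₀ / L₁.  Per curve; U₀ (26024) stays OPEN class-wide; BSD is NOT proved by this.
[cite: JetchevSkinnerWan2017, §7.4.2 (p. 31)] [cite: PastenShimura2024, Prop. 6.13, Lemma 6.18] [cite: SilvermanAEC2009, VII.5 Prop. 5.1] [cite: Cremona2006, Table 1 (Cremona label 426915p1)] -/
theorem u0_at_426915p1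
    (hGZK : rank_eq_analyticRank_of_analyticRank_le_one) (hmod : hasEntireLFunction_rat)
    (hnf : exists_isNewformOf) (hJL : nonempty_shimuraParametrizationData)
    (hCO : PastenShimura2024_componentOrders)
    (hHK : shimuraCurve_heegnerPoint_grossZagier_kolyvagin)
    {W : WeierstrassCurve ℚ} [W.IsElliptic] [W.IsGloballyMinimal] (hWeq : W = (⟨1, -1, 0, 3351, -7732⟩ : WeierstrassCurve ℚ))
    (hN : W.conductorNorm ℤ = 426915) [NeZero (W.conductorNorm ℤ)] (hr : W.analyticRank = 0)
    (Dt : ModularParametrizationData W (W.conductorNorm ℤ)) (hc : ¬ (3 : ℤ) ∣ Dt.c)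
    (hLt0 : (W.quadraticTwist (((-23 : ℤ) : ℚ))).entireLFunction 1 = 0)
    (hLt1 : deriv (W.quadraticTwist (((-23 : ℤ) : ℚ))).entireLFunction 1 ≠ 0)
    {qd : ℚ} (hqd : haveI := isElliptic_sWd426915p1; shaAn (⟨1, -1, 0, 1772580, 83439575⟩ : WeierstrassCurve ℚ) = (qd : ℂ))
    (hvd : padicValRat 3 qd ≤ 0) :
    MissingUpperBoundAt W 3 := by
  subst hWeq
  haveI := isElliptic_sWd426915p1; haveI := isGloballyMinimal_sWd426915p1
  have hI : integralModelInt (⟨1, -1, 0, 3351, -7732⟩ : WeierstrassCurve ℚ) = (⟨1, -1, 0, 3351, -7732⟩ : WeierstrassCurve ℤ) :=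
    integralModelInt_eq_of_map_eq _ (map_mk_int 1 (-1) 0 3351 (-7732))
  have hGS := subGss_three_426915p1 (W := (⟨1, -1, 0, 3351, -7732⟩ : WeierstrassCurve ℚ)) rfl
  have hs₁ : haveI : Fact (Nat.Prime 5) := ⟨by norm_num⟩; (⟨1, -1, 0, 3351, -7732⟩ : WeierstrassCurve ℚ).HasSplitMultiplicativeReductionAtPrime 5 := by
    refine IntModel.hasSplitMultiplicativeReductionAtPrime_of_intModel_of_root (hp := ⟨by norm_num⟩) hI 5 (by rw [Δ_eq_426915p1]; norm_num) (by rw [c₄_eq_426915p1]; norm_num) ⟨0, ?_⟩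
    simp only [WeierstrassCurve.c₄, WeierstrassCurve.b₂, WeierstrassCurve.b₄, WeierstrassCurve.b₆]; push_cast; decide
  have hs₂ : haveI : Fact (Nat.Prime 53) := ⟨by norm_num⟩; (⟨1, -1, 0, 3351, -7732⟩ : WeierstrassCurve ℚ).HasSplitMultiplicativeReductionAtPrime 53 := by
    refine IntModel.hasSplitMultiplicativeReductionAtPrime_of_intModel_of_root (hp := ⟨by norm_num⟩) hI 53 (by rw [Δ_eq_426915p1]; norm_num) (by rw [c₄_eq_426915p1]; norm_num) ⟨25, ?_⟩
    simp only [WeierstrassCurve.c₄, WeierstrassCurve.b₂, WeierstrassCurve.b₄, WeierstrassCurve.b₆]; push_cast; decide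
  haveI : Fact ((-23 : ℤ) < 0) := ⟨by norm_num⟩; haveI : Fact (Nat.Prime 5) := ⟨by norm_num⟩; haveI : Fact (Nat.Prime 53) := ⟨by norm_num⟩
  have hothers : ∀ (ℓ : ℕ) [Fact ℓ.Prime], ℓ ≠ 5 → ℓ ≠ 53 → (⟨1, -1, 0, 3351, -7732⟩ : WeierstrassCurve ℚ).HasSplitMultiplicativeReductionAtPrime ℓ →
      ¬ 3 ∣ padicValInt ℓ (⟨1, -1, 0, 3351, -7732⟩ : WeierstrassCurve ℚ).minimalDiscriminantInt := by
    intro ℓ hℓF hne₁ hne₂ hs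
    have hd := dvd_minimalDiscriminantInt_of_mult _ ℓ hs.hasMultiplicativeReductionAtPrime
    rw [IntModel.minimalDiscriminantInt_eq hI, Δ_eq_426915p1] at hd
    have hmem := mem_of_prime_dvd_of_prodPow_eq _ krausList_426915p1 hℓF.out hd
    simp only [List.map_cons, List.map_nil, List.mem_cons, List.not_mem_nil, or_false] at hmem
    rcases hmem with rfl | rfl | rfl | rfl
    · exact absurd hs.hasMultiplicativeReductionAtPrime (X9.PrintCert.not_hasMultiplicativeReductionAtPrime_of_dvd_of_dvd hI 3 (by rw [Δ_eq_426915p1]; norm_num) (by rw [c₄_eq_426915p1]; norm_num))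
    · exact absurd rfl hne₁
    · exact absurd rfl hne₂
    · rw [IntModel.minimalDiscriminantInt_eq hI, Δ_eq_426915p1, IntModel.padicValInt_eq_of_dvd_of_not_dvd 179 (e := 1) (by norm_num) (by norm_num)]
      decide
  have hshape : ∀ (q : ℕ) [Fact q.Prime], 3 ∣ ((⟨1, -1, 0, 3351, -7732⟩ : WeierstrassCurve ℚ).baseChange ℚ_[q]).localTamagawaNumber ℤ_[q] →
      (⟨1, -1, 0, 3351, -7732⟩ : WeierstrassCurve ℚ).HasSplitMultiplicativeReductionAtPrime q := by
    intro q hqF h3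
    by_cases hd : (q : ℤ) ∣ minimalDiscriminantInt (⟨1, -1, 0, 3351, -7732⟩ : WeierstrassCurve ℚ)
    swap
    · exact absurd h3 (not_three_dvd_localTamagawaNumber_of_not_dvd _ q hd)
    rw [IntModel.minimalDiscriminantInt_eq hI, Δ_eq_426915p1] at hd
    have hmem := mem_of_prime_dvd_of_prodPow_eq _ krausList_426915p1 hqF.out hd
    simp only [List.map_cons, List.map_nil, List.mem_cons, List.not_mem_nil, or_false] at hmem
    rcases hmem with rfl | rfl | rfl | rfl
    · have hc3 : ((⟨1, -1, 0, 3351, -7732⟩ : WeierstrassCurve ℚ).baseChange ℚ_[3]).localTamagawaNumber ℤ_[3] = 1 := -- additive `3` (I0*): Tate certificate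
        (IntModelTam.localTamagawaNumber_padic_eq_of_intModel_of_tamZ hI 3 (F := ⟨3, 9, 1, 1, 4, 6, 0, 0⟩) rfl (by decide +kernel)).trans (by decide)
      rw [hc3] at h3; exact absurd h3 (by decide)
    · exact hs₁
    · exact hs₂
    · exact (Koly.split_and_three_dvd_of_mult_of_three_dvd_localTamagawaNumber _ 179 (IntModel.hasMultiplicativeReductionAtPrime_of_intModel hI 179 (by rw [Δ_eq_426915p1]; norm_num) (by rw [c₄_eq_426915p1]; norm_num)) h3).1
  have hjac : ∀ ℓ : ℕ, ℓ.Prime → ℓ ∣ (⟨1, -1, 0, 3351, -7732⟩ : WeierstrassCurve ℚ).conductorNorm ℤ → ℓ ≠ 5 → ℓ ≠ 53 → ℓ ≠ 2 →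
      jacobiSym (-23) ℓ = 1 := by
    intro ℓ hℓ hℓN hne₁ hne₂ hℓ2
    rw [hN] at hℓN
    have hmem : ℓ ∈ Nat.primeFactors 426915 := Nat.mem_primeFactors.mpr ⟨hℓ, hℓN, by norm_num⟩
    rw [show Nat.primeFactors 426915 = {3, 5, 53, 179} by decide +kernel] at hmem
    simp only [Finset.mem_insert, Finset.mem_singleton] at hmem
    rcases hmem with rfl | rfl | rfl | rfl
    · norm_num [jacobiSym.mod_left]
    · exact absurd rfl hne₁
    · exact absurd rfl hne₂
    · norm_num [jacobiSym.mod_left]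
  have hWd : (⟨1, (-6 : ℚ), ((1:ℚ)/2), (0 : ℚ)⟩ : VariableChange ℚ) • (⟨1, -1, 0, 3351, -7732⟩ : WeierstrassCurve ℚ).quadraticTwist (((-23 : ℤ) : ℚ)) =
      (⟨1, -1, 0, 1772580, 83439575⟩ : WeierstrassCurve ℚ) := by
    push_cast; ext <;> simp [WeierstrassCurve.variableChange_a₁, WeierstrassCurve.variableChange_a₂,
      WeierstrassCurve.variableChange_a₃, WeierstrassCurve.variableChange_a₄, WeierstrassCurve.variableChange_a₆,
      WeierstrassCurve.quadraticTwist, WeierstrassCurve.b₂, WeierstrassCurve.b₄, WeierstrassCurve.b₆] <;> norm_num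
  exact leafRankZeroUpper_three_of_twoCarriers_of_sqrtField hGZK hmod hnf hJL hCO hHK _ hGS.1 hGS.2 hr rfl Dt hc
    (q₁ := 5) (q₂ := 53) (by decide) hs₁ hs₂ hothers hshape (by decide) (by decide)
    (-23) (by norm_num)
    (by rw [show (-23 : ℤ).natAbs = 23 by rfl, Nat.squarefree_iff_nodup_primeFactorsList (by norm_num)]; simp)
    (Or.inr ⟨by decide, by norm_num [jacobiSym.mod_left]⟩) (by norm_num) (by norm_num [jacobiSym.mod_left]) (by norm_num) hjac
    (fun h _ ↦ by rw [hN] at h; norm_num at h) hLt0 hLt1 _ _ hWd hqd hvd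

/-! ## §28 `438570z1` = `[1, -1, 0, 26301, -2093995]`, `N = 438570 = 2·3^2·5·11·443` (`2`: I7, `c = 1`, non-split, `3`: I₀*, `c = 1`, `5`: I3, `c = 3`, split, `11`: I3, `c = 3`, split, `443`: I2, `c = 2`, non-split); carriers `S = {5, 11}` (split, `3 ∣ ord Δ`), (DEG) by Papikian–Rabinoff at `q₂ = 11` (odd, `≡ 2 (mod 3)`);
`r_an = 0`, `#E(ℚ)_tors = 1`, `∏ c_ℓ = 18`, `#Ш(E)_an = 1` (Cremona/LMFDB, displayed where used); class `438570z` of size 1.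
`V = E^{(-3)}_min = [1, -1, 1, 2922, 76581]` (`#Ṽ(𝔽₃) = 7`).  JSW field `K = ℚ(√-23)` (`23` prime; `5`, `11` inert, every other `ℓ ∣ N` split): the least such `D` (among those tried) with a CERTIFIED twist unit
(kit j318499: root no. `−1`, `L′(Wd,1) = 1.485499`, `Wd = E^{(-23)}_min = [1, -1, 0, 13913130, 25394158196]`, `N(Wd) = 232003530`, `∏c = 4`, `T = 1`, point by `ellrank(effort=0)`, eclib-full saturation (index 1), `ĥ = 5.823446`,
`X = L′T²/(Ω∏c ĥ) = 1` to `2e-16` — the numerical `#Ш(Wd)_an` given rank `1`). -/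

/-- `V = [1, -1, 1, 2922, 76581]` (the minimal model of `438570z1^{(-3)}`, conductor `48730`): `Δ ≠ 0` in the kernel. [cite: Cremona2006, Table 1 (Cremona label 438570z1)] -/
theorem isElliptic_sV438570z1 : (⟨1, -1, 1, 2922, 76581⟩ : WeierstrassCurve ℚ).IsElliptic :=
  isElliptic_of_discOf_ne_zero 1 (-1) 1 2922 76581 (by decide +kernel)

/-- `V` is globally minimal: `|Δ| = 2^7·5^3·11^3·443^2` kernel-checked, Kraus' criterion prime by prime. [cite: Kraus1989, Prop. 1 and Prop. 2]
[cite: SilvermanAEC2009, VII.1 Remark 1.1] [cite: Cremona2006, Table 1 (Cremona label 438570z1)] -/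
theorem isGloballyMinimal_sV438570z1 : (⟨1, -1, 1, 2922, 76581⟩ : WeierstrassCurve ℚ).IsGloballyMinimal :=
  isGloballyMinimal_of_krausCriterion₃_factored 1 (-1) 1 2922 76581
    [(2, 7), (5, 3), (11, 3), (443, 2)] (by decide +kernel)
    (by intro qe hqe; simp only [List.mem_cons, List.not_mem_nil, or_false] at hqe
        rcases hqe with rfl | rfl | rfl | rfl <;> norm_num)
    (by set_option synthInstance.maxSize 2000 in decide +kernel)

/-- `Wd = [1, -1, 0, 13913130, 25394158196]` (the minimal model of the twist `438570z1^{(-23)}`, conductor `232003530`): `Δ ≠ 0` in the kernel. [cite: Cremona2006, Table 1 (Cremona label 438570z1)] -/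
theorem isElliptic_sWd438570z1 : (⟨1, -1, 0, 13913130, 25394158196⟩ : WeierstrassCurve ℚ).IsElliptic :=
  isElliptic_of_discOf_ne_zero 1 (-1) 0 13913130 25394158196 (by decide +kernel)

/-- `Wd` is globally minimal: `|Δ| = 2^7·3^6·5^3·11^3·23^6·443^2` kernel-checked, Kraus' criterion prime by prime. [cite: Kraus1989, Prop. 1 and Prop. 2]
[cite: SilvermanAEC2009, VII.1 Remark 1.1] [cite: Cremona2006, Table 1 (Cremona label 438570z1)] -/
theorem isGloballyMinimal_sWd438570z1 : (⟨1, -1, 0, 13913130, 25394158196⟩ : WeierstrassCurve ℚ).IsGloballyMinimal :=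
  isGloballyMinimal_of_krausCriterion₃_factored 1 (-1) 0 13913130 25394158196
    [(2, 7), (3, 6), (5, 3), (11, 3), (23, 6), (443, 2)] (by decide +kernel)
    (by intro qe hqe; simp only [List.mem_cons, List.not_mem_nil, or_false] at hqe
        rcases hqe with rfl | rfl | rfl | rfl | rfl | rfl <;> norm_num)
    (by set_option synthInstance.maxSize 2000 in decide +kernel)

/-- **`438570z1` is ADDITIVE at `3` and on the cell (G) ∧ ss, IN THE KERNEL**: `3 ∣ Δ`, `3 ∣ c₄`; `C • V^{(-3)} = E` (`[u, r, s, t] = [1, -1, 1/2, 0]`) with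
`V` globally minimal, `3 ∤ Δ(V)`, `#Ṽ(𝔽₃) = 7` (`a₃(V) = -3`, supersingular), whence `TypeG`, `SubGord`, `SubGss` at `3` (g13's block, unchanged).
[cite: SilvermanAEC2009, VII.5 Prop. 5.1 (a), (c)] [cite: Delbourgo1998, §1.5 (G)] [cite: Cremona2006, Table 1 (Cremona label 438570z1)] -/
theorem subGss_three_438570z1 {W : WeierstrassCurve ℚ} [W.IsElliptic] [W.IsGloballyMinimal] (hWeq : W = (⟨1, -1, 0, 26301, -2093995⟩ : WeierstrassCurve ℚ)) :
    Addv W 3 ∧ SubGss W 3 := by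
  subst hWeq
  haveI := isElliptic_sV438570z1
  haveI := isGloballyMinimal_sV438570z1
  have hIW : integralModelInt (⟨1, -1, 0, 26301, -2093995⟩ : WeierstrassCurve ℚ) = (⟨1, -1, 0, 26301, -2093995⟩ : WeierstrassCurve ℤ) :=
    integralModelInt_eq_of_map_eq _ (map_mk_int 1 (-1) 0 26301 (-2093995))
  have hadd : Addv (⟨1, -1, 0, 26301, -2093995⟩ : WeierstrassCurve ℚ) 3 := Additive.addv_of_intModel hIW 3 (by decide +kernel) (by decide +kernel)
  have hIV : integralModelInt (⟨1, -1, 1, 2922, 76581⟩ : WeierstrassCurve ℚ) = (⟨1, -1, 1, 2922, 76581⟩ : WeierstrassCurve ℤ) :=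
    integralModelInt_eq_of_map_eq _ (map_mk_int 1 (-1) 1 2922 76581)
  have hcV : Nat.card ((((⟨1, -1, 1, 2922, 76581⟩ : WeierstrassCurve ℤ)).map (Int.castRingHom (ZMod 3))).toAffine.Point) = 7 := by
    have h := natCard_point_eq_countPoints 1 (-1) 1 2922 76581 3 (by norm_num) (by decide +kernel)
    have h' : countPoints [1, -1, 1, 2922, 76581] 3 = 7 := countPoints_eq_of_fast (by decide +kernel)
    exact_mod_cast h.trans h'
  have hgood : GoodSS (⟨1, -1, 1, 2922, 76581⟩ : WeierstrassCurve ℚ) 3 := Supersingular.goodSS_of_intModel 3 hIV (by decide +kernel) hcV (by decide)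
  have hVW : (⟨1, (-1 : ℚ), ((1:ℚ)/2), (0 : ℚ)⟩ : VariableChange ℚ) • (⟨1, -1, 1, 2922, 76581⟩ : WeierstrassCurve ℚ).quadraticTwist (-3) =
      (⟨1, -1, 0, 26301, -2093995⟩ : WeierstrassCurve ℚ) := by
    ext <;> simp [WeierstrassCurve.variableChange_a₁, WeierstrassCurve.variableChange_a₂,
      WeierstrassCurve.variableChange_a₃, WeierstrassCurve.variableChange_a₄, WeierstrassCurve.variableChange_a₆,
      WeierstrassCurve.quadraticTwist, WeierstrassCurve.b₂, WeierstrassCurve.b₄, WeierstrassCurve.b₆] <;> norm_num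
  obtain ⟨C, hC⟩ := exists_variableChange_quadraticTwist_symm (⟨1, -1, 0, 26301, -2093995⟩ : WeierstrassCurve ℚ)
    (⟨1, -1, 1, 2922, 76581⟩ : WeierstrassCurve ℚ) (d := (-3 : ℚ)) (by norm_num) ⟨_, hVW⟩
  have hC' : C • (⟨1, -1, 0, 26301, -2093995⟩ : WeierstrassCurve ℚ).quadraticTwist ((-1 : ℚ) ^ ((3 : ℕ) / 2) * (3 : ℕ)) =
      (⟨1, -1, 1, 2922, 76581⟩ : WeierstrassCurve ℚ) := by
    rw [O5.pstar_three]; exact hC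
  have hG : TypeG (⟨1, -1, 0, 26301, -2093995⟩ : WeierstrassCurve ℚ) 3 := (typeG_three_iff_good_twist _ hadd _ C hC').mpr hgood.1
  exact ⟨hadd, (O5.subGss_three_iff_subGord_and_goodSS_twist _ hadd _ C hC).mpr
    ⟨subGord_three_of_typeG_of_addv _ hG hadd, hgood⟩⟩

/-- `Δ(E₀) = -3046723335216000 = -2^7·3^6·5^3·11^3·443^2` on the integer equation of `438570z1`. [cite: Cremona2006, Table 1 (Cremona label 438570z1)] -/
theorem Δ_eq_438570z1 : (⟨1, -1, 0, 26301, -2093995⟩ : WeierstrassCurve ℤ).Δ = -3046723335216000 := by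
  norm_num [WeierstrassCurve.Δ, WeierstrassCurve.b₂, WeierstrassCurve.b₄, WeierstrassCurve.b₆, WeierstrassCurve.b₈]

/-- `c₄(E₀) = -1262439` on the integer equation of `438570z1`. [cite: Cremona2006, Table 1 (Cremona label 438570z1)] -/
theorem c₄_eq_438570z1 : (⟨1, -1, 0, 26301, -2093995⟩ : WeierstrassCurve ℤ).c₄ = -1262439 := by
  norm_num [WeierstrassCurve.c₄, WeierstrassCurve.b₂, WeierstrassCurve.b₄]

/-- The Kraus list of `438570z1` consists of primes and multiplies to `|Δ(E₀)|`, IN THE KERNEL: a prime dividing `Δ_min` is one of `[2, 3, 5, 11, 443]`. [cite: Cremona2006, Table 1 (Cremona label 438570z1)] -/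
theorem krausList_438570z1 : (∀ qe ∈ ([(2, 7), (3, 6), (5, 3), (11, 3), (443, 2)] : List (ℕ × ℕ)), qe.1.Prime) ∧
    (([(2, 7), (3, 6), (5, 3), (11, 3), (443, 2)] : List (ℕ × ℕ)).map fun qe => qe.1 ^ qe.2).prod = (-3046723335216000 : ℤ).natAbs :=
  ⟨by decide +kernel, by decide +kernel⟩

/-- **U₀ AT `438570z1` BY THE INERT-CARRIER (Shimura-curve) ROAD, TU₀|inert** — `MissingUpperBoundAt W 3` at `W = E` (`r_an = 0`) from rhp-p2 g10's certificate shape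
p662479 `leafRankZeroUpper_three_of_shimuraInertDatum_of_twistUnitZero` (Papikian–Rabinoff (DEG) at the odd carrier) through the §0 door `leafRankOneUpper_three_of_twoCarriers_of_sqrtField` of part one.  PRINTED: `hGZK hmod hnf hJL hCO hHK`.  KERNEL: `Addv ∧ SubGss` at `3`;
`5`, `11` split (nodal roots `1`, `2`); every prime of `Δ_min` enumerated (`krausList_438570z1`) for `hothers` and `hshape` (`c = 1` off `Δ_min`, Kodaira–Néron at the
multiplicative primes, Tate certificates at the additive primes `[3]`); the congruences making `5`, `11` inert and the other `ℓ ∣ N` split in `ℚ(√-23)`; the twist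
identity `Cd • E^{(-23)} = Wd`, `Cd = [1, -6, 1/2, 0]`, with `Wd` Kraus-minimal.  DISPLAYED: `hN`, `hr` (`r_an = 0`), `Dt`/`hc` (`3 ∤ c(Dt)`), `hLt0`/`hLt1` (`L(E^{(-23)},1) = 0 ≠ L′(E^{(-23)},1)`; census: root number `−1`, `L′(Wd,1) ≈ 1.485499`),
`hqd`/`hvd` (`#Ш(Wd)_an = 1`; census: `X = L′·T²/(Ω·∏c·ĥ(P)) = 1` to `2.2e-16` at the eclib-full-saturated point `P` of height `5.823446` found by `ellrank(effort=0)`).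
NO ¬CM / S2 / Σ / L₀ / L₁.  Per curve; U₀ (26024) stays OPEN class-wide; BSD is NOT proved by this.
[cite: JetchevSkinnerWan2017, §7.4.2 (p. 31)] [cite: PastenShimura2024, Prop. 6.13, Lemma 6.18] [cite: SilvermanAEC2009, VII.5 Prop. 5.1] [cite: Cremona2006, Table 1 (Cremona label 438570z1)] -/
theorem u0_at_438570z1
    (hGZK : rank_eq_analyticRank_of_analyticRank_le_one) (hmod : hasEntireLFunction_rat)
    (hnf : exists_isNewformOf) (hJL : nonempty_shimuraParametrizationData)
    (hCO : PastenShimura2024_componentOrders)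
    (hHK : shimuraCurve_heegnerPoint_grossZagier_kolyvagin)
    {W : WeierstrassCurve ℚ} [W.IsElliptic] [W.IsGloballyMinimal] (hWeq : W = (⟨1, -1, 0, 26301, -2093995⟩ : WeierstrassCurve ℚ))
    (hN : W.conductorNorm ℤ = 438570) [NeZero (W.conductorNorm ℤ)] (hr : W.analyticRank = 0)
    (Dt : ModularParametrizationData W (W.conductorNorm ℤ)) (hc : ¬ (3 : ℤ) ∣ Dt.c)
    (hLt0 : (W.quadraticTwist (((-23 : ℤ) : ℚ))).entireLFunction 1 = 0)
    (hLt1 : deriv (W.quadraticTwist (((-23 : ℤ) : ℚ))).entireLFunction 1 ≠ 0)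
    {qd : ℚ} (hqd : haveI := isElliptic_sWd438570z1; shaAn (⟨1, -1, 0, 13913130, 25394158196⟩ : WeierstrassCurve ℚ) = (qd : ℂ))
    (hvd : padicValRat 3 qd ≤ 0) :
    MissingUpperBoundAt W 3 := by
  subst hWeq
  haveI := isElliptic_sWd438570z1; haveI := isGloballyMinimal_sWd438570z1
  have hI : integralModelInt (⟨1, -1, 0, 26301, -2093995⟩ : WeierstrassCurve ℚ) = (⟨1, -1, 0, 26301, -2093995⟩ : WeierstrassCurve ℤ) :=
    integralModelInt_eq_of_map_eq _ (map_mk_int 1 (-1) 0 26301 (-2093995))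
  have hGS := subGss_three_438570z1 (W := (⟨1, -1, 0, 26301, -2093995⟩ : WeierstrassCurve ℚ)) rfl
  have hs₁ : haveI : Fact (Nat.Prime 5) := ⟨by norm_num⟩; (⟨1, -1, 0, 26301, -2093995⟩ : WeierstrassCurve ℚ).HasSplitMultiplicativeReductionAtPrime 5 := by
    refine IntModel.hasSplitMultiplicativeReductionAtPrime_of_intModel_of_root (hp := ⟨by norm_num⟩) hI 5 (by rw [Δ_eq_438570z1]; norm_num) (by rw [c₄_eq_438570z1]; norm_num) ⟨1, ?_⟩
    simp only [WeierstrassCurve.c₄, WeierstrassCurve.b₂, WeierstrassCurve.b₄, WeierstrassCurve.b₆]; push_cast; decide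
  have hs₂ : haveI : Fact (Nat.Prime 11) := ⟨by norm_num⟩; (⟨1, -1, 0, 26301, -2093995⟩ : WeierstrassCurve ℚ).HasSplitMultiplicativeReductionAtPrime 11 := by
    refine IntModel.hasSplitMultiplicativeReductionAtPrime_of_intModel_of_root (hp := ⟨by norm_num⟩) hI 11 (by rw [Δ_eq_438570z1]; norm_num) (by rw [c₄_eq_438570z1]; norm_num) ⟨2, ?_⟩
    simp only [WeierstrassCurve.c₄, WeierstrassCurve.b₂, WeierstrassCurve.b₄, WeierstrassCurve.b₆]; push_cast; decide
  haveI : Fact ((-23 : ℤ) < 0) := ⟨by norm_num⟩; haveI : Fact (Nat.Prime 5) := ⟨by norm_num⟩; haveI : Fact (Nat.Prime 11) := ⟨by norm_num⟩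
  have hothers : ∀ (ℓ : ℕ) [Fact ℓ.Prime], ℓ ≠ 5 → ℓ ≠ 11 → (⟨1, -1, 0, 26301, -2093995⟩ : WeierstrassCurve ℚ).HasSplitMultiplicativeReductionAtPrime ℓ →
      ¬ 3 ∣ padicValInt ℓ (⟨1, -1, 0, 26301, -2093995⟩ : WeierstrassCurve ℚ).minimalDiscriminantInt := by
    intro ℓ hℓF hne₁ hne₂ hs
    have hd := dvd_minimalDiscriminantInt_of_mult _ ℓ hs.hasMultiplicativeReductionAtPrime
    rw [IntModel.minimalDiscriminantInt_eq hI, Δ_eq_438570z1] at hd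
    have hmem := mem_of_prime_dvd_of_prodPow_eq _ krausList_438570z1 hℓF.out hd
    simp only [List.map_cons, List.map_nil, List.mem_cons, List.not_mem_nil, or_false] at hmem
    rcases hmem with rfl | rfl | rfl | rfl | rfl
    · rw [IntModel.minimalDiscriminantInt_eq hI, Δ_eq_438570z1, IntModel.padicValInt_eq_of_dvd_of_not_dvd 2 (e := 7) (by norm_num) (by norm_num)]
      decide
    · exact absurd hs.hasMultiplicativeReductionAtPrime (X9.PrintCert.not_hasMultiplicativeReductionAtPrime_of_dvd_of_dvd hI 3 (by rw [Δ_eq_438570z1]; norm_num) (by rw [c₄_eq_438570z1]; norm_num))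
    · exact absurd rfl hne₁
    · exact absurd rfl hne₂
    · rw [IntModel.minimalDiscriminantInt_eq hI, Δ_eq_438570z1, IntModel.padicValInt_eq_of_dvd_of_not_dvd 443 (e := 2) (by norm_num) (by norm_num)]
      decide
  have hshape : ∀ (q : ℕ) [Fact q.Prime], 3 ∣ ((⟨1, -1, 0, 26301, -2093995⟩ : WeierstrassCurve ℚ).baseChange ℚ_[q]).localTamagawaNumber ℤ_[q] →
      (⟨1, -1, 0, 26301, -2093995⟩ : WeierstrassCurve ℚ).HasSplitMultiplicativeReductionAtPrime q := by
    intro q hqF h3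
    by_cases hd : (q : ℤ) ∣ minimalDiscriminantInt (⟨1, -1, 0, 26301, -2093995⟩ : WeierstrassCurve ℚ)
    swap
    · exact absurd h3 (not_three_dvd_localTamagawaNumber_of_not_dvd _ q hd)
    rw [IntModel.minimalDiscriminantInt_eq hI, Δ_eq_438570z1] at hd
    have hmem := mem_of_prime_dvd_of_prodPow_eq _ krausList_438570z1 hqF.out hd
    simp only [List.map_cons, List.map_nil, List.mem_cons, List.not_mem_nil, or_false] at hmem
    rcases hmem with rfl | rfl | rfl | rfl | rfl
    · exact (Koly.split_and_three_dvd_of_mult_of_three_dvd_localTamagawaNumber _ 2 (IntModel.hasMultiplicativeReductionAtPrime_of_intModel hI 2 (by rw [Δ_eq_438570z1]; norm_num) (by rw [c₄_eq_438570z1]; norm_num)) h3).1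
    · have hc3 : ((⟨1, -1, 0, 26301, -2093995⟩ : WeierstrassCurve ℚ).baseChange ℚ_[3]).localTamagawaNumber ℤ_[3] = 1 := -- additive `3` (I0*): Tate certificate
        (IntModelTam.localTamagawaNumber_padic_eq_of_intModel_of_tamZ hI 3 (F := ⟨3, 9, 1, 1, 4, 6, 0, 0⟩) rfl (by decide +kernel)).trans (by decide)
      rw [hc3] at h3; exact absurd h3 (by decide)
    · exact hs₁
    · exact hs₂
    · exact (Koly.split_and_three_dvd_of_mult_of_three_dvd_localTamagawaNumber _ 443 (IntModel.hasMultiplicativeReductionAtPrime_of_intModel hI 443 (by rw [Δ_eq_438570z1]; norm_num) (by rw [c₄_eq_438570z1]; norm_num)) h3).1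
  have hjac : ∀ ℓ : ℕ, ℓ.Prime → ℓ ∣ (⟨1, -1, 0, 26301, -2093995⟩ : WeierstrassCurve ℚ).conductorNorm ℤ → ℓ ≠ 5 → ℓ ≠ 11 → ℓ ≠ 2 →
      jacobiSym (-23) ℓ = 1 := by
    intro ℓ hℓ hℓN hne₁ hne₂ hℓ2
    rw [hN] at hℓN
    have hmem : ℓ ∈ Nat.primeFactors 438570 := Nat.mem_primeFactors.mpr ⟨hℓ, hℓN, by norm_num⟩
    rw [show Nat.primeFactors 438570 = {2, 3, 5, 11, 443} by decide +kernel] at hmem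
    simp only [Finset.mem_insert, Finset.mem_singleton] at hmem
    rcases hmem with rfl | rfl | rfl | rfl | rfl
    · exact absurd rfl hℓ2
    · norm_num [jacobiSym.mod_left]
    · exact absurd rfl hne₁
    · exact absurd rfl hne₂
    · norm_num [jacobiSym.mod_left]
  have hWd : (⟨1, (-6 : ℚ), ((1:ℚ)/2), (0 : ℚ)⟩ : VariableChange ℚ) • (⟨1, -1, 0, 26301, -2093995⟩ : WeierstrassCurve ℚ).quadraticTwist (((-23 : ℤ) : ℚ)) =
      (⟨1, -1, 0, 13913130, 25394158196⟩ : WeierstrassCurve ℚ) := by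
    push_cast; ext <;> simp [WeierstrassCurve.variableChange_a₁, WeierstrassCurve.variableChange_a₂,
      WeierstrassCurve.variableChange_a₃, WeierstrassCurve.variableChange_a₄, WeierstrassCurve.variableChange_a₆,
      WeierstrassCurve.quadraticTwist, WeierstrassCurve.b₂, WeierstrassCurve.b₄, WeierstrassCurve.b₆] <;> norm_num
  exact leafRankZeroUpper_three_of_twoCarriers_of_sqrtField hGZK hmod hnf hJL hCO hHK _ hGS.1 hGS.2 hr rfl Dt hc
    (q₁ := 5) (q₂ := 11) (by decide) hs₁ hs₂ hothers hshape (by decide) (by decide)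
    (-23) (by norm_num)
    (by rw [show (-23 : ℤ).natAbs = 23 by rfl, Nat.squarefree_iff_nodup_primeFactorsList (by norm_num)]; simp)
    (Or.inr ⟨by decide, by norm_num [jacobiSym.mod_left]⟩) (by norm_num) (by norm_num [jacobiSym.mod_left]) (by norm_num) hjac
    (fun _ _ ↦ by norm_num) hLt0 hLt1 _ _ hWd hqd hvd

end Summit.BirchSwinnertonDyer.BirchSwinnertonDyer.Theorems.RamifiedHeegnerPairTwistUnitInertZero

end
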